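import Summits.ResolutionOfSingularities.ResolutionOfSingularities.Theorems.FrobeniusClosingPatchingRelPerfectDepthMixedTargetsB
import Summits.ResolutionOfSingularities.ResolutionOfSingularities.Theorems.FrobeniusClosingPatchingRelPerfectMonomialSumLocalPair
import Summits.ResolutionOfSingularities.ResolutionOfSingularities.Theorems.FrobeniusClosingPatchingRelPerfectMonomialRungClosed
import HarnessLib

/-!
# Crux `PatchingRelPerfect` (stmt-ResolutionOfSingularities-16161), chain W5.2 — T7β-M «LOCAL MONOMIAL-SUM GAME»:
# the (β) END-consumer, design-independent

[OURS · L1 W5.2 · rung tool · res-L1-w52-plan-1 NAMING G10-6 (2) 2026-08-27T14:33:26Z] res-type-003 g8.  Every variant of the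
(β) format (`MultiHostFormatB`, res-D-pv-021) and of (β)-ci ends in a `k`-summand MONOMIAL SUM `monomialSum 𝒦 = ⨆_i Π_F F^{a_{i,F}}`
on a common member family `Es` which is simple normal crossings only on an OPEN `U ⊇ cosupp`.  This file states and PROVES the
END-consumer target:

* `LocalMonomialSumGame` — `LocalPairGame` (`…DepthMixedTargetsB`, T5-M) with the pair `(A, B)` replaced by a non-empty family
  `𝒦 : List (List (X.IdealSheafData × ℕ))` with `boundaryOf K = Es` for every `K ∈ 𝒦`: on a Noetherian regular `X`, if
  `Es|_U` is snc and `cosupp (monomialSum 𝒦) ⊆ U`, some sequence of blowings up with regular centres over the cosupport, with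
  regular top, principalizes `monomialSum 𝒦`;
* `monomialSumPrincipalization_local` — the content along any open immersion `j : U ⟶ X` (= `monomialSumPrincipalization_local_pair`
  of `…MonomialSumLocalPair` with the binder `𝒦.length ≤ 2` DELETED: the game on `U` is M2 `monomialSumPrincipalization_holds`
  (`…MonomialRungClosed`, from the polyhedra game `globalPermissiblePolyhedraGame_holds`), its centres lie over `j⁻¹ cosupp`, closed in
  `X`, and `CentreSeqExtend.exists_centreSeq_of_open` extends it);
* **`localMonomialSumGame_holds : LocalMonomialSumGame`** (the `localPairGame_holds` wrapper pattern, `j = U.ι`), and the pair game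
  as its special case `localPairGame_of_localMonomialSumGame`.

Fact-free (tree theorems only); nothing here is a statement of the manuscript under review (AI-written, weaker than expert review).

## References
* J. Kollár, *Lectures on Resolution of Singularities* (2007), (3.111) Step 3. [Kollar2007]
* U. Görtz, T. Wedhorn, *Algebraic Geometry I*, 2nd ed. (2020), Prop. 13.91 (1)–(2) (blow-ups and flat / open base change). [GortzWedhorn2020]
* R. A. Goward, *A simple algorithm for principalization of monomial ideals*, Trans. AMS 357 (2005), §2. [Goward2005]
-/

-- `Summit.<Summit>.<Sub>.Theorems` with `Sub = Summit` (single-conjunct summit, D-0017)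
set_option linter.dupNamespace false

noncomputable section

open CategoryTheory AlgebraicGeometry TopologicalSpace
open Literature.AlgebraicGeometry.Resolution

namespace Summit.ResolutionOfSingularities.ResolutionOfSingularities.Theorems.DepthTargets

open CentreSeqExtend

universe u

/-! ## §1 The target -/

/-- [OURS · L1 W5.2 · T7β-M] **S-TARGET «LOCAL MONOMIAL-SUM GAME»** (`LocalPairGame` with the pair replaced by a non-empty family of
exponent lists on one member family `Es`): on a Noetherian regular scheme `X`, for an open `U`, a family `Es` of ideal sheaves whose
restrictions to `U` are simple normal crossings, and exponent lists `𝒦 ≠ []` on `Es` whose monomial SUM is cosupported in `U`,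
some sequence of blowings up with regular centres over `cosupp (monomialSum 𝒦)`, with regular top, makes `monomialSum 𝒦` locally
principal.  PROVED below (`localMonomialSumGame_holds`). (cf. Kollar2007, (3.111) Step 3; Goward2005 §2; GortzWedhorn2020
Prop. 13.91 — OURS node; pointer in prose, the Prop being parameterless.) -/
def LocalMonomialSumGame : Prop :=
  ∀ (X : Scheme.{u}) [IsNoetherian X], Scheme.IsRegular X →
    ∀ (U : X.Opens) (Es : List X.IdealSheafData) (𝒦 : List (List (X.IdealSheafData × ℕ))),
      (∀ K ∈ 𝒦, boundaryOf K = Es) → 𝒦 ≠ [] →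
      HasSNC (Es.map fun F => F.comap U.ι) →
      ((monomialSum 𝒦).support : Set X) ⊆ (U : Set X) →
        ∃ s : CentreSeq X, s.AllRegular ∧
          s.CentresOver ((monomialSum 𝒦).support : Set X) ∧
          Scheme.IsRegular s.top ∧ IsLocallyPrincipal ((monomialSum 𝒦).comap s.comp)

/-! ## §2 The content along an open immersion -/

/-- **The monomial-sum game LOCALISED** (`monomialSumPrincipalization_local_pair` without `𝒦.length ≤ 2`): `X` regular
Noetherian, `j : U ⟶ X` an open immersion from a Noetherian scheme, `Es` ideal sheaves of `X` with `HasSNC (Es.map (·|_U))`,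
`𝒦 ≠ []` exponent lists on `Es` with `cosupp (monomialSum 𝒦) ⊆ j(U)`; then a multiple blow-up of `X` with regular centres over the
cosupport, regular top, principalizes `monomialSum 𝒦`: play M2 (`monomialSumPrincipalization_holds`) on `U` and extend
(`CentreSeqExtend.exists_centreSeq_of_open`; the cosupport is closed in `X`). [cite: GortzWedhorn2020, Prop. 13.91 (1)–(2)]
[cite: Goward2005, §2] -/
theorem monomialSumPrincipalization_local {X U : Scheme.{u}} [IsNoetherian X] [IsNoetherian U]
    (hX : Scheme.IsRegular X) (j : U ⟶ X) [IsOpenImmersion j] (Es : List X.IdealSheafData)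
    (hEs : HasSNC (Es.map (·.comap j))) (𝒦 : List (List (X.IdealSheafData × ℕ)))
    (h𝒦 : ∀ K ∈ 𝒦, boundaryOf K = Es) (hne : 𝒦 ≠ [])
    (hsupp : ((monomialSum 𝒦).support : Set X) ⊆ Set.range j.base) :
    ∃ s : CentreSeq X, s.AllRegular ∧ s.CentresOver ((monomialSum 𝒦).support : Set X) ∧
      Scheme.IsRegular s.top ∧ IsLocallyPrincipal ((monomialSum 𝒦).comap s.comp) := by
  -- the pulled-back family on `U`
  set 𝒦' : List (List (U.IdealSheafData × ℕ)) := 𝒦.map fun A => A.map fun p => (p.1.comap j, p.2)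
    with h𝒦'
  have hsum : (monomialSum 𝒦).comap j = monomialSum 𝒦' := comap_monomialSum_eq_map 𝒦 j
  have h𝒦'b : ∀ K ∈ 𝒦', boundaryOf K = Es.map (·.comap j) := by
    intro K hK
    obtain ⟨A, hA, rfl⟩ := List.mem_map.mp hK
    rw [boundaryOf_map_comap, h𝒦 A hA]
  have hne' : 𝒦' ≠ [] := by
    rw [h𝒦']
    exact fun h => hne (List.map_eq_nil_iff.mp h)
  -- M2 on `U`
  obtain ⟨s, hreg, hover, -, hlp⟩ := monomialSumPrincipalization_holds U
    (Scheme.IsRegular.of_isOpenImmersion j hX) (Es.map (·.comap j)) hEs 𝒦' h𝒦'b hne'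
  -- its centres lie over `j⁻¹ cosupp`, a set CLOSED IN `X`
  have hover' : s.CentresOver (j.base ⁻¹' ((monomialSum 𝒦).support : Set X)) := by
    have h : ((monomialSum 𝒦').support : Set U) = j.base ⁻¹' ((monomialSum 𝒦).support : Set X) := by
      rw [← hsum, Scheme.IdealSheafData.support_comap]
      rfl
    rw [← h]
    exact hover
  -- extend to `X`
  obtain ⟨t, htreg, htover, httop, htlp⟩ := exists_centreSeq_of_open hX j (monomialSum 𝒦).support.isClosed
    hsupp s hreg hover'
  exact ⟨t, htreg, htover, httop, htlp (monomialSum 𝒦) le_rfl (by rw [hsum]; exact hlp)⟩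

/-! ## §3 The target closed by name, and the pair game as a special case -/

/-- **T7β-M `LocalMonomialSumGame` holds** (the game on `U`, extended to `X`; `j = U.ι`). [cite: Kollar2007, (3.111) Step 3]
[cite: GortzWedhorn2020, Prop. 13.91 (1)–(2)] -/
theorem localMonomialSumGame_holds : LocalMonomialSumGame.{u} := by
  intro X _ hX U Es 𝒦 h𝒦 hne hsnc hsupp
  haveI : CompactSpace (U : Scheme.{u}) :=
    isCompact_iff_compactSpace.mp (TopologicalSpace.NoetherianSpace.isCompact (U : Set X))
  haveI : IsNoetherian (U : Scheme.{u}) := ⟨⟩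
  have hsupp' : ((monomialSum 𝒦).support : Set X) ⊆ Set.range U.ι.base := by
    rw [Scheme.Opens.range_ι]
    exact hsupp
  exact monomialSumPrincipalization_local hX U.ι Es hsnc 𝒦 h𝒦 hne hsupp'

/-- The pair game T5-M is the case `𝒦 = [A, B]`, `Es = boundaryOf A` of the monomial-sum game. [folklore] -/
theorem localPairGame_of_localMonomialSumGame (h : LocalMonomialSumGame.{u}) : LocalPairGame.{u} := by
  intro X _ hX U A B hAB hsnc hsupp
  have h𝒦 : ∀ K ∈ [A, B], boundaryOf K = boundaryOf A := by
    intro K hK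
    simp only [List.mem_cons, List.not_mem_nil, or_false] at hK
    rcases hK with rfl | rfl
    · rfl
    · exact hAB.symm
  have hsupp' : ((monomialSum [A, B]).support : Set X) ⊆ (U : Set X) := by
    rw [monomialSum_pair]
    exact hsupp
  obtain ⟨s, h1, h2, h3, h4⟩ := h X hX U (boundaryOf A) [A, B] h𝒦 (List.cons_ne_nil _ _) hsnc hsupp'
  rw [monomialSum_pair] at h2 h4
  exact ⟨s, h1, h2, h3, h4⟩

end Summit.ResolutionOfSingularities.ResolutionOfSingularities.Theorems.DepthTargets

end
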